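/-
Origin: expansion seat `planner-pub-hodgecm-pv09-g4-0`, handover #8 2026-08-18T07:45:02Z (`HOME/pub-hodgecm-pv09-g4/lean/Pv09g4/ModelTransport.lean`, md5 3156b872, 242 lines);
landed by the gen-7 packager in gate run 26 as `HodgeCM/PerL34/ModelTransport.lean` (import ^import Pv[0-9]+g[0-9]+\.→import HodgeCM.PerL34. ×1).
-/
/-
HodgeCM / PerL34 publication cell — seam S3 set-up residue (pub-hodgecm-pv09-g4, HANDOVER #8).
Imports: `Pv09g4.RallisHeadline` (my run-26 #7) ↦ `HodgeCM.PerL34.RallisHeadline`; the tree module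
`HodgeCM.PerL34.NormOneRelTorus` (pv11-g4, run 25).  Complete proofs, no new axioms, nothing cited.
-/
import Summits.HodgeConjecture.HodgeCM.PerL34.RallisHeadline
import Summits.HodgeConjecture.HodgeCM.PerL34.NormOneRelTorus_2

/-!
# Seam S3 — transporting "discrete + cocompact" from the idelic model, and the headline over a MODEL MAP

The S3 headline (`RallisHeadline.lean`) takes the two set-up facts about the rational points
`Γ = jA.range ≤ A = Πʳ_i [G_i, B_i]` as instances: `[DiscreteTopology Γ]`, `[CompactSpace (A ⧸ Γ)]`.
pv11-g4 proved both IN THE KERNEL for the idelic model of the automorphic torus of a hermitian line,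
`relNormOneRat K L ≤ relNormOneIdeles K L` (`L¹ ≤ U(1)_{L/K}(𝔸_K)`).  This file isolates exactly what is then
left of the set-up: a MODEL MAP between the abstract restricted product and the idelic torus.

* `discreteTopology_of_continuous_hom` — discreteness of a subgroup pulls back along a continuous hom that is
  injective on it and maps it into a discrete subgroup (pure topology);
* `compactSpace_quotient_of_continuous_hom` — cocompactness pushes forward along a continuous SURJECTIVE hom
  mapping the one subgroup into the other (pure topology; the descended map `A' ⧸ Γ' → A ⧸ Γ` is a continuous
  surjection from a compact space);
* `discreteTopology_range_of_model`, `compactSpace_quot_of_model` — the two S3 instances from a continuous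
  injective hom `A →* U(1)_{L/K}(𝔸_K)` carrying `jA(U(L))` into `L¹`, resp. a continuous surjective hom
  `U(1)_{L/K}(𝔸_K) →* A` carrying `L¹` into `jA(U(L))` — in particular from ONE isomorphism of topological groups
  `e : A ≃ₜ* relNormOneIdeles K L` with `e(jA(U(L))) = L¹` (`instances_of_modelEquiv`);
* `exists_compactDomain_thetaLift_ne_zero_of_model` — the S3 HEADLINE (theta lift `Θ_φ(χ′) ≠ 0`) with the two
  instances REPLACED by such a model isomorphism: the honest residual set-up input of seam S3 is now the single
  datum "the restricted product of the local unitary groups `U(W_i)(L_{0,v})` with its diagonal `U(W_i)(L₀)` IS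
  (isomorphic to) `U(1)_{L/K}(𝔸_K) ⊇ L¹`", i.e. the standard identification `U(W_i) ≅ U(1)_{L/K}` for a hermitian
  LINE plus `U(1)(𝔸_K) = Πʳ_v U(1)(K_v)` — a statement about the MODEL, not about automorphic forms.
-/

set_option autoImplicit false

noncomputable section

open MeasureTheory MeasureTheory.Measure Set Metric Function Complex ComplexConjugate Topology
open scoped RestrictedProduct InnerProductSpace NNReal ENNReal

namespace HodgeCM.PerL34.DiscreteFD

/-! ## §1  Pure topology: transport of discreteness and of cocompactness along homomorphisms -/

section transport

variable {A A' : Type*} [Group A] [TopologicalSpace A] [Group A'] [TopologicalSpace A']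

/-- Discreteness of `Γ ≤ A` pulls back along a continuous hom `g : A →* A'` injective on `Γ` with `g(Γ) ⊆ Γ'`,
`Γ'` discrete. -/
theorem discreteTopology_of_continuous_hom (g : A →* A') (hg : Continuous g) (Γ : Subgroup A)
    (Γ' : Subgroup A') (hΓ : ∀ γ ∈ Γ, g γ ∈ Γ') (hinj : Set.InjOn g Γ) [DiscreteTopology Γ'] :
    DiscreteTopology Γ := by
  refine DiscreteTopology.of_continuous_injective
    (f := fun γ : Γ => (⟨g γ, hΓ γ γ.2⟩ : Γ')) ?_ ?_
  · exact (hg.comp continuous_subtype_val).subtype_mk _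
  · intro x y hxy
    exact Subtype.ext (hinj x.2 y.2 (congrArg Subtype.val hxy))

/-- Cocompactness of `Γ ≤ A` follows from cocompactness of `Γ' ≤ A'` along a continuous SURJECTIVE hom
`f : A' →* A` with `f(Γ') ⊆ Γ`: the descended map `A' ⧸ Γ' → A ⧸ Γ` is a continuous surjection. -/
theorem compactSpace_quotient_of_continuous_hom (f : A' →* A) (hf : Continuous f)
    (hsurj : Function.Surjective f) (Γ' : Subgroup A') (Γ : Subgroup A) (hΓ : ∀ γ ∈ Γ', f γ ∈ Γ)
    [CompactSpace (A' ⧸ Γ')] : CompactSpace (A ⧸ Γ) := by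
  have H : ∀ a b : A', @Setoid.r _ (QuotientGroup.leftRel Γ') a b →
      @Setoid.r _ (QuotientGroup.leftRel Γ) (f a) (f b) := by
    intro a b hab
    rw [QuotientGroup.leftRel_apply] at hab ⊢
    rw [← map_inv, ← map_mul]
    exact hΓ _ hab
  let F : A' ⧸ Γ' → A ⧸ Γ := Quotient.map' f H
  have hF : Continuous F := hf.quotient_map' H
  have hsF : Function.Surjective F := by
    intro q
    induction q using QuotientGroup.induction_on with
    | H a =>
      obtain ⟨a', rfl⟩ := hsurj a
      exact ⟨QuotientGroup.mk a', rfl⟩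
  refine ⟨?_⟩
  rw [← hsF.range_eq]
  exact isCompact_range hF

/-- Both transports at once along an isomorphism of topological groups `e : A ≃ₜ* A'` with `e(Γ) = Γ'`. -/
theorem discreteTopology_of_mulEquiv (e : A ≃ₜ* A') (Γ : Subgroup A) (Γ' : Subgroup A')
    (hΓ : ∀ γ ∈ Γ, e γ ∈ Γ') [DiscreteTopology Γ'] : DiscreteTopology Γ :=
  discreteTopology_of_continuous_hom e.toMulEquiv.toMonoidHom e.continuous Γ Γ' hΓ
    (e.injective.injOn)

/-- (Ported verbatim from the HodgeCMPerL package; no docstring in the source.) -/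
theorem compactSpace_quotient_of_mulEquiv (e : A ≃ₜ* A') (Γ : Subgroup A)
    (Γ' : Subgroup A') (hΓ' : ∀ γ ∈ Γ', e.symm γ ∈ Γ) [CompactSpace (A' ⧸ Γ')] : CompactSpace (A ⧸ Γ) :=
  compactSpace_quotient_of_continuous_hom e.symm.toMulEquiv.toMonoidHom e.symm.continuous e.symm.surjective
    Γ' Γ hΓ'

end transport

/-! ## §2  The two S3 instances from a model map to pv11-g4's idelic torus `L¹ ≤ U(1)_{L/K}(𝔸_K)` -/

section model

open NumberField

variable {ι : Type} {G : ι → Type} [∀ i, Group (G i)] [∀ i, TopologicalSpace (G i)]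
  (B : ∀ i, Subgroup (G i))
  {U : Type*} [Group U] (jA : U →* Πʳ j, [G j, B j])
  (K L : Type) [Field K] [Field L] [NumberField L] [Algebra K L] [FiniteDimensional K L]

/-- `jA(U)` is DISCRETE as soon as a continuous hom `A →* U(1)_{L/K}(𝔸_K)`, injective on `jA(U)`, carries it into
`L¹` (pv11-g4: `L¹` is discrete, kernel). -/
theorem discreteTopology_range_of_model (g : (Πʳ j, [G j, B j]) →* relNormOneIdeles K L) (hg : Continuous g)
    (hinj : Set.InjOn g (jA.range : Subgroup (Πʳ j, [G j, B j])))
    (hcomm : ∀ d : U, g (jA d) ∈ relNormOneRat K L) :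
    DiscreteTopology (jA.range : Subgroup (Πʳ j, [G j, B j])) :=
  discreteTopology_of_continuous_hom g hg jA.range (relNormOneRat K L)
    (by rintro _ ⟨d, rfl⟩; exact hcomm d) hinj

/-- `A ⧸ jA(U)` is COMPACT as soon as a continuous surjective hom `U(1)_{L/K}(𝔸_K) →* A` carries `L¹` into
`jA(U)` (pv11-g4: `U(1)_{L/K}(𝔸_K) ⧸ L¹` is compact, kernel). -/
theorem compactSpace_quot_of_model
    (f : relNormOneIdeles K L →* Πʳ j, [G j, B j]) (hf : Continuous f)
    (hsurj : Function.Surjective f) (hcomm : ∀ a ∈ relNormOneRat K L, f a ∈ jA.range) :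
    CompactSpace ((Πʳ j, [G j, B j]) ⧸ (jA.range : Subgroup (Πʳ j, [G j, B j]))) :=
  compactSpace_quotient_of_continuous_hom f hf hsurj (relNormOneRat K L) jA.range hcomm

/-- Both S3 instances from ONE model isomorphism `e : A ≃ₜ* U(1)_{L/K}(𝔸_K)` with `e(jA(U)) = L¹`
(stated as the two inclusions). -/
theorem instances_of_modelEquiv
    (e : (Πʳ j, [G j, B j]) ≃ₜ* relNormOneIdeles K L) (he : ∀ d : U, e (jA d) ∈ relNormOneRat K L)
    (he' : ∀ a ∈ relNormOneRat K L, e.symm a ∈ jA.range) :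
    DiscreteTopology (jA.range : Subgroup (Πʳ j, [G j, B j])) ∧
      CompactSpace ((Πʳ j, [G j, B j]) ⧸ (jA.range : Subgroup (Πʳ j, [G j, B j]))) :=
  ⟨discreteTopology_of_mulEquiv e jA.range (relNormOneRat K L) (by rintro _ ⟨d, rfl⟩; exact he d),
    compactSpace_quotient_of_mulEquiv e jA.range (relNormOneRat K L) he'⟩

end model

end HodgeCM.PerL34.DiscreteFD

/-! ## §3  The S3 headline over a model isomorphism -/

namespace HodgeCM.PerL34.PureTensor

open HodgeCM.PerL34.SplitShells HodgeCM.PerL34.AdelicFactorisation HodgeCM.PerL34.RestrictedMeasure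
open HodgeCM.PerL34.NoSmallSubgroups HodgeCM.PerL34.EulerFactorisation HodgeCM.PerL34.DiscreteFD
open HodgeCM.PerL34.LocalFactors HodgeCM.PerL34.LocalFactors.DilationModel
open HodgeCM.PerL34.LocalModulus HodgeCM.PerL34.SplitPlaceDilation
open HodgeCM.PerL34.RallisIP HodgeCM.PerL34.Doubling HodgeCM.PerL34.N31d NumberField

attribute [local instance] LocalFactors.DilationModel.Adic.nontriviallyNormedField
  LocalFactors.DilationModel.Adic.properSpace

section headlineModel

variable {ι : Type} {G : ι → Type} [∀ i, CommGroup (G i)] [∀ i, TopologicalSpace (G i)]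
  [∀ i, IsTopologicalGroup (G i)] [∀ i, T2Space (G i)] [∀ i, SecondCountableTopology (G i)]
  [∀ i, LocallyCompactSpace (G i)] [∀ i, MeasurableSpace (G i)] [∀ i, BorelSpace (G i)]
  [Countable ι] [DecidableEq ι]
  (B : ∀ i, Subgroup (G i)) (hBc : ∀ i, IsCompact (B i : Set (G i)))
  (hBo : ∀ i, IsOpen (B i : Set (G i))) (S₀ : Finset ι)
  {Sp : Type} [NormedAddCommGroup Sp] [InnerProductSpace ℂ Sp]
  {E : Type*} [NormedAddCommGroup E] [InnerProductSpace ℂ E]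
  {L : Type} [Field L] [StarRing L] {W : Type} [AddCommGroup W] [Module L W]
  {H Sbox : Type} [Group H] [AddCommGroup Sbox] [Module ℂ Sbox]
  {h : W →ₗ⋆[L] W →ₗ[L] L} (hW : IsLine L W) (hh : Anisotropic h)
  (D : DoublingDatum (Πʳ j, [G j, B j]) H Sp Sbox) (GU : ThetaSide Sp Sbox)
  -- the idelic MODEL (pv11-g4): `U(1)_{L₁/K₁}(𝔸_{K₁}) ⊇ L₁¹`, and a model isomorphism carrying `jA(U(L))` onto `L₁¹`
  (K₁ L₁ : Type) [Field K₁] [Field L₁] [NumberField L₁] [Algebra K₁ L₁] [FiniteDimensional K₁ L₁]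
  (jA : unitary L →* Πʳ j, [G j, B j]) (hjA : Function.Injective jA)
  (e : (Πʳ j, [G j, B j]) ≃ₜ* relNormOneIdeles K₁ L₁) (he : ∀ d : unitary L, e (jA d) ∈ relNormOneRat K₁ L₁)
  (he' : ∀ a ∈ relNormOneRat K₁ L₁, e.symm a ∈ jA.range)
  (j : isomBox h →* H) (hj : ∀ d : unitary L, j ⟨iotaSnd d, iotaSnd_mem h d⟩ = D.ι (1, jA d))
  (χ : (Πʳ j, [G j, B j]) →* Circle) (hχΓ : ∀ d : unitary L, χ (jA d) = 1)
  (hχVΓ : ∀ d : unitary L, D.χV (jA d) = 1)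
  {hP : ∀ Ψ : Sbox, ∀ p ∈ (stabDelta L W).subgroupOf (isomBox h), ∀ x : H,
    D.fSW Ψ (j p * x) = D.fSW Ψ x}
  (P : GluePrintInputs D GU h j hP) (φ : Sp)
  (hφ : ‖φ‖ = 1)
  (hloc : ∀ (i : ι) (v : Sp), Continuous fun g : G i => D.ω (RestrictedProduct.mulSingle B i g) v)
  {T' : Finset ι} (hχT' : RestrictedProduct.boxSubgroup B T' ≤ χ.ker)
  (hlocχ : ∀ i ∈ T', Continuous fun g : G i => χ (RestrictedProduct.mulSingle B i g))
  {T : Finset ι} (hK : ∀ k ∈ RestrictedProduct.boxSubgroup B T, D.ω k φ = φ)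
  (hM : ∀ S : Finset ι, T ⊆ S → ∀ y : (i : ↥S) → G i,
    inner ℂ φ (D.ω (extendOne B S y) φ) = ∏ i : ↥S, localCoeff B D.ω φ i (y i))
  {S : Finset ι} {IsSplit : ι → Prop} (hTS : T ⊆ S) (hT'S : T' ⊆ S)
  (L₀ : Type) [Field L₀] [NumberField L₀]
  (w : ι → IsDedekindDomain.HeightOneSpectrum (NumberField.RingOfIntegers L₀))
  (hw : ∀ ⦃i j : ι⦄, i ∉ S → j ∉ S → w i = w j → i = j)
  [∀ i, MeasurableSpace ((w i).adicCompletion L₀)] [∀ i, BorelSpace ((w i).adicCompletion L₀)]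
  (ν : ∀ i, ((w i).adicCompletion L₀)ˣ →* Circle)
  (hBi : ∀ i, i ∉ S → ¬IsSplit i → (B i : Set (G i)) = Set.univ)
  (ord : ∀ i, G i →* Multiplicative ℤ) (ϖ : ∀ i, G i) (ϖF : ∀ i, ((w i).adicCompletion L₀)ˣ)
  (hϖF : ∀ i, i ∉ S → IsUniformizer (ϖF i))
  (ord_ϖ : ∀ i, i ∉ S → IsSplit i → ord i (ϖ i) = Multiplicative.ofAdd 1)
  (ker_ord : ∀ i, i ∉ S → IsSplit i → ∀ g : G i, ord i g = 1 ↔ g ∈ B i)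
  (hν : ∀ i, i ∉ S → IsSplit i → ∀ u : ((w i).adicCompletion L₀)ˣ,
    ‖(u : (w i).adicCompletion L₀)‖ = 1 → ν i u = 1)
  (coeff_eq : ∀ i, i ∉ S → IsSplit i → ∀ n : ℤ, localCoeff B D.ω φ i (ϖ i ^ n)
    = ⟪ballIndicator (Adic.muV L₀ (w i)) 0 1,
        dilationRep (Adic.muV L₀ (w i)) (ν i) (ϖF i ^ n) (ballIndicator (Adic.muV L₀ (w i)) 0 1)⟫_ℂ)
  (τ : ∀ i, i ∈ S → IsSplit i → (G i ≃ₜ* ((w i).adicCompletion L₀)ˣ))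
  (x₀ : ∀ i, Fin 3 → (w i).adicCompletion L₀) (r cS : ι → ℝ)
  (hr : ∀ i ∈ S, IsSplit i → r i < ‖x₀ i‖) (hr0 : ∀ i ∈ S, IsSplit i → 0 < r i)
  (hcS : ∀ i ∈ S, IsSplit i → 0 < cS i)
  (hνS : ∀ i ∈ S, IsSplit i → ∀ y : ((w i).adicCompletion L₀)ˣ,
    (y : (w i).adicCompletion L₀) ∈ U1 (x₀ i) (r i) → ν i y = 1)
  (hχS : ∀ i (hi : i ∈ S) (hs : IsSplit i), ∀ g : G i,
    ((τ i hi hs g : ((w i).adicCompletion L₀)ˣ) : (w i).adicCompletion L₀) ∈ U1 (x₀ i) (r i) →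
      χ (RestrictedProduct.mulSingle B i g) = 1)
  (coeffS : ∀ i (hi : i ∈ S) (hs : IsSplit i), ∀ g : G i, localCoeff B D.ω φ i g
    = (cS i : ℂ) * ⟪ballIndicator (Adic.muV L₀ (w i)) (x₀ i) (r i),
        dilationRep (Adic.muV L₀ (w i)) (ν i) (τ i hi hs g) (ballIndicator (Adic.muV L₀ (w i)) (x₀ i) (r i))⟫_ℂ)
  (hcpt : ∀ i ∈ S, ¬IsSplit i → CompactSpace (G i))
  (hiso : ∀ i ∈ S, ¬IsSplit i → ∀ g : G i, D.ω (RestrictedProduct.mulSingle B i g) φ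
    = conj (((χ (RestrictedProduct.mulSingle B i g) : Circle) : ℂ)) • φ)

include hW hh hjA he he' hj hχΓ hχVΓ P hφ hloc hχT' hlocχ hK hM hTS hT'S hw hBi hϖF ord_ϖ ker_ord hν
  coeff_eq hr hr0 hcS hνS hχS coeffS hcpt hiso

/-- **S3 HEADLINE over a MODEL ISOMORPHISM**: `exists_compactDomain_thetaLift_ne_zero_of_N31d_adic` with its two
set-up instances `[DiscreteTopology jA.range] [CompactSpace (A ⧸ jA.range)]` REPLACED by one isomorphism of
topological groups `e : A ≃ₜ* U(1)_{L₁/K₁}(𝔸_{K₁})` carrying `jA(U(L))` onto `L₁¹` — discreteness and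
cocompactness then come from pv11-g4's kernel theorems. -/
theorem exists_compactDomain_thetaLift_ne_zero_of_model [IsFiniteMeasure GU.μ] :
    ∃ 𝓕 : Set (Πʳ j, [G j, B j]), IsCompact 𝓕 ∧ (interior 𝓕).Nonempty ∧ MeasurableSet 𝓕 ∧
      IsFundamentalDomain jA.range 𝓕 (haarDatum B hBc hBo S₀).μ ∧
      (haarDatum B hBc hBo S₀).μ 𝓕 ≠ 0 ∧ (haarDatum B hBc hBo S₀).μ 𝓕 ≠ ⊤ ∧
      ∀ [IsFiniteMeasure (((haarDatum B hBc hBo S₀).μ).restrict 𝓕)]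
        (hk : Measurable (Function.uncurry (thetaFn D GU φ))) {Ck : ℝ} (hCk : 0 ≤ Ck)
        (hkC : ∀ q u, ‖thetaFn D GU φ q u‖ ≤ Ck),
        PeterssonFubini.theta GU.μ (((haarDatum B hBc hBo S₀).μ).restrict 𝓕) hk
          (measurable_coe_char B hBo χ hχT' hlocχ) hCk hkC (norm_coe_char_le χ) ≠ 0 := by
  obtain ⟨hdisc, hcpt'⟩ := instances_of_modelEquiv B jA K₁ L₁ e he he'
  haveI := hdisc
  haveI := hcpt'
  exact exists_compactDomain_thetaLift_ne_zero_of_N31d_adic B hBc hBo S₀ hW hh D GU jA hjA j hj χ hχΓ hχVΓ P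
    φ hφ hloc hχT' hlocχ hK hM hTS hT'S L₀ w hw ν hBi ord ϖ ϖF hϖF ord_ϖ ker_ord hν coeff_eq τ x₀ r cS hr
    hr0 hcS hνS hχS coeffS hcpt hiso

end headlineModel

end HodgeCM.PerL34.PureTensor

end
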